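import Literature.Probability.LatticeModels.LatticeGraph
import Literature.Probability.Percolation.SharpnessDCTProofs
import Literature.Probability.Percolation.SlabCriticality
import Literature.Probability.Percolation.SeedLemma

/-!
# Crux `PercNonProliferation.FreeBoxSparse` (stmt-CriticalPhenomena-4445), line `ccfs-window-kissing-walls` —
# tools for assembling `stub_collar` from its three registered pieces (lead's helper, part 1: tile units;
# registered sub-goal `stub_collar_tiles`)

Def-free lemmas about the UNIT FAMILY attached to a finite `Λ ⊂ ℤ³` and an arbitrary "tile index" map
`t : Site 3 → Site 3`: the unit of index `ι` is the set of lattice edges of `Λ.sym2` whose two endpoints have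
index `ι`,
`U_t(ι) = (Λ.sym2).filter (fun e => e ∈ E(ℤ³) ∧ ∀ z ∈ e, t z = ι)`, and the family is `(Λ.image t).image U_t`.
We record: units consist of lattice edges inside `Λ.sym2`; distinct units are disjoint; the family has at most
`|Λ|` members; a unit has at most `C(|fibre|+1, 2)` edges; a ball lying in `Λ` and in one fibre of `t` has all its
lattice edges in the corresponding unit ("good tile ⇒ good unit"); and for the half-shifted cubic tilings
`t z = ((z j - o j) / L)_j` the fibres have at most `L³` points.
-/

noncomputable section

namespace Summit.CriticalPhenomena.PercolationContinuityZ3.Theorems.FreeBoxSparse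

open MeasureTheory Filter
open Literature.Probability.Percolation Literature.Probability.LatticeModels
open scoped Topology Classical

namespace StubCollarAssembly

/-- Members of a unit are lattice edges lying in `Λ.sym2`. [folklore] -/
theorem mem_unit_iff (Λ : Finset (Site 3)) (t : Site 3 → Site 3) (ι : Site 3) (e : Sym2 (Site 3)) :
    e ∈ (Λ.sym2).filter (fun e => e ∈ (zdGraph 3).edgeSet ∧ ∀ z ∈ e, t z = ι) ↔
      e ∈ Λ.sym2 ∧ e ∈ (zdGraph 3).edgeSet ∧ ∀ z ∈ e, t z = ι := by
  rw [Finset.mem_filter]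

/-- Every member of the unit family consists of lattice edges of `Λ.sym2`. [folklore] -/
theorem units_subset (Λ : Finset (Site 3)) (t : Site 3 → Site 3) :
    ∀ W ∈ (Λ.image t).image (fun ι => (Λ.sym2).filter (fun e => e ∈ (zdGraph 3).edgeSet ∧ ∀ z ∈ e, t z = ι)),
      ∀ e ∈ W, e ∈ (zdGraph 3).edgeSet ∧ e ∈ Λ.sym2 := by
  intro W hW e he
  obtain ⟨ι, -, rfl⟩ := Finset.mem_image.1 hW
  rw [mem_unit_iff] at he
  exact ⟨he.2.1, he.1⟩

/-- Two units sharing an edge are equal (the index is read off any endpoint). [folklore] -/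
theorem unit_eq_of_mem_of_mem {Λ : Finset (Site 3)} {t : Site 3 → Site 3} {ι ι' : Site 3} {e : Sym2 (Site 3)}
    (he : e ∈ (Λ.sym2).filter (fun e => e ∈ (zdGraph 3).edgeSet ∧ ∀ z ∈ e, t z = ι))
    (he' : e ∈ (Λ.sym2).filter (fun e => e ∈ (zdGraph 3).edgeSet ∧ ∀ z ∈ e, t z = ι')) : ι = ι' := by
  rw [mem_unit_iff] at he he'
  obtain ⟨z, hz⟩ : ∃ z, z ∈ e := ⟨e.out.1, Sym2.out_fst_mem e⟩
  rw [← he.2.2 z hz, ← he'.2.2 z hz]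

/-- The unit family is pairwise disjoint. [folklore] -/
theorem units_pairwiseDisjoint (Λ : Finset (Site 3)) (t : Site 3 → Site 3) :
    (↑((Λ.image t).image (fun ι => (Λ.sym2).filter (fun e => e ∈ (zdGraph 3).edgeSet ∧ ∀ z ∈ e, t z = ι))) :
      Set (Finset (Sym2 (Site 3)))).PairwiseDisjoint id := by
  intro W hW W' hW' hne
  rw [Finset.mem_coe] at hW hW'
  obtain ⟨ι, -, rfl⟩ := Finset.mem_image.1 hW
  obtain ⟨ι', -, rfl⟩ := Finset.mem_image.1 hW'
  rw [Function.onFun, id, id, Finset.disjoint_left]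
  intro e he he'
  exact hne (by rw [unit_eq_of_mem_of_mem he he'])

/-- The unit family has at most `|Λ|` members. [folklore] -/
theorem card_units_le (Λ : Finset (Site 3)) (t : Site 3 → Site 3) :
    ((Λ.image t).image (fun ι => (Λ.sym2).filter (fun e => e ∈ (zdGraph 3).edgeSet ∧ ∀ z ∈ e, t z = ι))).card
      ≤ Λ.card :=
  Finset.card_image_le.trans Finset.card_image_le

/-- A unit lies in the `sym2` of its fibre. [folklore] -/
theorem unit_subset_sym2_fibre (Λ : Finset (Site 3)) (t : Site 3 → Site 3) (ι : Site 3) :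
    (Λ.sym2).filter (fun e => e ∈ (zdGraph 3).edgeSet ∧ ∀ z ∈ e, t z = ι) ⊆ (Λ.filter fun z => t z = ι).sym2 := by
  intro e he
  rw [mem_unit_iff] at he
  rw [Finset.mem_sym2_iff]
  intro z hz
  exact Finset.mem_filter.2 ⟨Finset.mem_sym2_iff.1 he.1 z hz, he.2.2 z hz⟩

/-- Size of a unit: at most `C(f+1, 2)` edges if its fibre has at most `f` points. [folklore] -/
theorem card_unit_le {Λ : Finset (Site 3)} {t : Site 3 → Site 3} {ι : Site 3} {f : ℕ}
    (hf : (Λ.filter fun z => t z = ι).card ≤ f) :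
    ((Λ.sym2).filter (fun e => e ∈ (zdGraph 3).edgeSet ∧ ∀ z ∈ e, t z = ι)).card ≤ (f + 1).choose 2 :=
  calc ((Λ.sym2).filter (fun e => e ∈ (zdGraph 3).edgeSet ∧ ∀ z ∈ e, t z = ι)).card
      ≤ ((Λ.filter fun z => t z = ι).sym2).card := Finset.card_le_card (unit_subset_sym2_fibre Λ t ι)
    _ = ((Λ.filter fun z => t z = ι).card + 1).choose 2 := Finset.card_sym2 _
    _ ≤ (f + 1).choose 2 := Nat.choose_le_choose 2 (by omega)

/-- **Good tile ⇒ good unit**: if a vertex set `B ⊆ Λ` lies in one fibre of `t`, all lattice edges inside `B`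
belong to the unit of that fibre. [folklore] -/
theorem mk_mem_unit_of_subset {Λ : Finset (Site 3)} {t : Site 3 → Site 3} {ι : Site 3} {B : Finset (Site 3)}
    (hB : B ⊆ Λ) (hBt : ∀ z ∈ B, t z = ι) {b c : Site 3} (hb : b ∈ B) (hc : c ∈ B) (hadj : (zdGraph 3).Adj b c) :
    s(b, c) ∈ (Λ.sym2).filter (fun e => e ∈ (zdGraph 3).edgeSet ∧ ∀ z ∈ e, t z = ι) := by
  rw [mem_unit_iff]
  refine ⟨Finset.mk_mem_sym2_iff.2 ⟨hB hb, hB hc⟩, (SimpleGraph.mem_edgeSet _).2 hadj, ?_⟩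
  intro z hz
  rcases Sym2.mem_iff.1 hz with rfl | rfl
  · exact hBt _ hb
  · exact hBt _ hc

/-- The unit of index `t a`, `a ∈ Λ`, belongs to the unit family. [folklore] -/
theorem unit_mem_units {Λ : Finset (Site 3)} (t : Site 3 → Site 3) {a : Site 3} (ha : a ∈ Λ) :
    (Λ.sym2).filter (fun e => e ∈ (zdGraph 3).edgeSet ∧ ∀ z ∈ e, t z = t a) ∈
      (Λ.image t).image (fun ι => (Λ.sym2).filter (fun e => e ∈ (zdGraph 3).edgeSet ∧ ∀ z ∈ e, t z = ι)) :=
  Finset.mem_image.2 ⟨t a, Finset.mem_image_of_mem t ha, rfl⟩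

/-! ### The half-shifted cubic tilings: fibres have at most `L³` points -/

/-- A point of the fibre of index `ι` of the tiling map `z ↦ ((z j - o j) / L)_j` (`L > 0`) lies in the cube
`Π_j [ι j L + o j, ι j L + o j + L - 1]`. [folklore] -/
theorem mem_Icc_of_tileIdx_eq {L : ℤ} (hL : 0 < L) (o ι z : Site 3)
    (h : (fun j => (z j - o j) / L) = ι) :
    z ∈ Finset.Icc (fun j => ι j * L + o j) (fun j => ι j * L + o j + (L - 1)) := by
  rw [Finset.mem_Icc]
  constructor
  · intro j
    have hj : (z j - o j) / L = ι j := congrFun h j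
    have h1 := Int.mul_ediv_self_le (x := z j - o j) hL.ne'
    rw [hj] at h1
    show ι j * L + o j ≤ z j
    linarith [mul_comm L (ι j)]
  · intro j
    have hj : (z j - o j) / L = ι j := congrFun h j
    have h2 := Int.lt_mul_ediv_self_add (x := z j - o j) hL
    rw [hj] at h2
    show z j ≤ ι j * L + o j + (L - 1)
    linarith [mul_comm L (ι j)]

/-- The cube `Π_j [c j, c j + (L-1)]` has `L.toNat³` points. [folklore] -/
theorem card_Icc_cube (L : ℤ) (c : Site 3) :
    (Finset.Icc c (fun j => c j + (L - 1))).card = L.toNat ^ 3 := by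
  rw [Pi.card_Icc]
  have h : ∀ j : Fin 3, (Finset.Icc (c j) (c j + (L - 1))).card = L.toNat := by
    intro j
    rw [Int.card_Icc]
    congr 1
    omega
  rw [Finset.prod_congr rfl fun j _ => h j, Finset.prod_const, Finset.card_univ, Fintype.card_fin]

/-- **Fibres of a cubic tiling have at most `L³` points.** [folklore] -/
theorem card_fibre_tile_le {L : ℤ} (hL : 0 < L) (o ι : Site 3) (Λ : Finset (Site 3)) :
    (Λ.filter fun z => (fun j => (z j - o j) / L) = ι).card ≤ L.toNat ^ 3 := by
  rw [← card_Icc_cube L (fun j => ι j * L + o j)]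
  refine Finset.card_le_card fun z hz => ?_
  exact mem_Icc_of_tileIdx_eq hL o ι z (Finset.mem_filter.1 hz).2


/-! ### The sprinkled "many good units" event is determined by the pairs of `Λ` -/

/-- Configurations agreeing on `Λ.sym2` agree on every `{a ↔ b inside Λ}`. [folklore] -/
theorem openConnIn_congr_of_inter_eq {Λ : Finset (Site 3)} {ω ω' : BondConfig (Site 3)}
    (h : ω ∩ (↑(Λ.sym2) : Set (Sym2 (Site 3))) = ω' ∩ ↑(Λ.sym2)) (a b : Site 3) :
    ω ∈ openConnIn (↑Λ : Set (Site 3)) a b ↔ ω' ∈ openConnIn (↑Λ : Set (Site 3)) a b :=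
  (determinedBy_iff _ _).1
    (DCT16.determinedBy_openConnIn (↑Λ : Set (Site 3)) a b (K := (↑(Λ.sym2) : Set (Sym2 (Site 3))))
      (by rw [Finset.coe_sym2])) ω ω' h

/-- **The event "two `δ`-dense pieces of `Λ`, unjoined in `Λ`, with at least `m` good units" is determined by
`Λ.sym2`** (all its atoms are events `{a ↔ b inside Λ}`). [folklore] -/
theorem determinedBy_goodUnitsEvent (Λ : Finset (Site 3)) (𝒰 : Finset (Finset (Sym2 (Site 3)))) (δ : ℝ)
    (r m : ℕ) :
    DeterminedBy {ω' : BondConfig (Site 3) | ∃ x ∈ Λ, ∃ y ∈ Λ,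
        δ * (Λ.card : ℝ) ≤ (((Λ.filter fun v => ω' ∈ openConnIn ↑Λ x v)).card : ℝ) ∧
        δ * (Λ.card : ℝ) ≤ (((Λ.filter fun v => ω' ∈ openConnIn ↑Λ y v)).card : ℝ) ∧
        ω' ∉ openConnIn ↑Λ x y ∧
        m ≤ (𝒰.filter fun W => ∃ a : Site 3, (box 3 r).image (· + a) ⊆ Λ ∧
          (∀ b ∈ (box 3 r).image (· + a), ∀ c ∈ (box 3 r).image (· + a), (zdGraph 3).Adj b c → s(b, c) ∈ W) ∧
          (∃ u ∈ Λ, (Finset.univ.sup fun j : Fin 3 => (u j - a j).natAbs) ≤ r ∧ ω' ∈ openConnIn ↑Λ x u) ∧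
          (∃ u ∈ Λ, (Finset.univ.sup fun j : Fin 3 => (u j - a j).natAbs) ≤ r ∧ ω' ∈ openConnIn ↑Λ y u)).card}
      (↑(Λ.sym2) : Set (Sym2 (Site 3))) := by
  rw [determinedBy_iff]
  intro ω ω' h
  have key : ∀ a b : Site 3,
      (ω ∈ openConnIn (↑Λ : Set (Site 3)) a b) = (ω' ∈ openConnIn (↑Λ : Set (Site 3)) a b) :=
    fun a b => propext (openConnIn_congr_of_inter_eq h a b)
  simp only [Set.mem_setOf_eq, key]

/-! ### Degenerate radius: for `r = 0` a doubly-met centre glues the two pieces -/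

/-- If `supDist u a ≤ 0` then `u = a`. [folklore] -/
theorem eq_of_sup_natAbs_le_zero {u a : Site 3}
    (h : (Finset.univ.sup fun j : Fin 3 => (u j - a j).natAbs) ≤ 0) : u = a := by
  funext j
  have hj : (u j - a j).natAbs ≤ 0 := (Finset.le_sup (f := fun j : Fin 3 => (u j - a j).natAbs)
    (Finset.mem_univ j)).trans h
  omega

/-- **For `r = 0` the collar event is empty**: a centre met by both pieces at sup-distance `0` is a common point
of the two pieces, which are then joined inside `Λ`. [folklore] -/
theorem not_mem_collarEvent_zero (Λ : Finset (Site 3)) (δ c : ℝ) (hc : 0 < c) (ω : BondConfig (Site 3)) :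
    ω ∉ {ω : BondConfig (Site 3) | ∃ x ∈ Λ, ∃ y ∈ Λ,
      δ * (Λ.card : ℝ) ≤ (((Λ.filter fun v => ω ∈ openConnIn ↑Λ x v)).card : ℝ) ∧
      δ * (Λ.card : ℝ) ≤ (((Λ.filter fun v => ω ∈ openConnIn ↑Λ y v)).card : ℝ) ∧
      ω ∉ openConnIn ↑Λ x y ∧
      c ≤ (Set.ncard {a : Site 3 | a ∈ Λ ∧ (box 3 0).image (· + a) ⊆ Λ ∧
        (∃ u ∈ Λ, (Finset.univ.sup fun j : Fin 3 => (u j - a j).natAbs) ≤ 0 ∧ ω ∈ openConnIn ↑Λ x u) ∧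
        (∃ u ∈ Λ, (Finset.univ.sup fun j : Fin 3 => (u j - a j).natAbs) ≤ 0 ∧ ω ∈ openConnIn ↑Λ y u)} : ℝ)} := by
  rintro ⟨x, -, y, -, -, -, hnot, hV⟩
  have hpos : 0 < Set.ncard {a : Site 3 | a ∈ Λ ∧ (box 3 0).image (· + a) ⊆ Λ ∧
      (∃ u ∈ Λ, (Finset.univ.sup fun j : Fin 3 => (u j - a j).natAbs) ≤ 0 ∧ ω ∈ openConnIn ↑Λ x u) ∧
      (∃ u ∈ Λ, (Finset.univ.sup fun j : Fin 3 => (u j - a j).natAbs) ≤ 0 ∧ ω ∈ openConnIn ↑Λ y u)} := by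
    have : (0 : ℝ) < Set.ncard {a : Site 3 | a ∈ Λ ∧ (box 3 0).image (· + a) ⊆ Λ ∧
      (∃ u ∈ Λ, (Finset.univ.sup fun j : Fin 3 => (u j - a j).natAbs) ≤ 0 ∧ ω ∈ openConnIn ↑Λ x u) ∧
      (∃ u ∈ Λ, (Finset.univ.sup fun j : Fin 3 => (u j - a j).natAbs) ≤ 0 ∧ ω ∈ openConnIn ↑Λ y u)} :=
      hc.trans_le hV
    exact_mod_cast this
  obtain ⟨a, ha⟩ := Set.nonempty_of_ncard_ne_zero hpos.ne'
  obtain ⟨-, -, ⟨u, -, hu, hxu⟩, ⟨u', -, hu', hyu'⟩⟩ := ha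
  have h1 : u = a := eq_of_sup_natAbs_le_zero hu
  have h2 : u' = a := eq_of_sup_natAbs_le_zero hu'
  subst h1; subst h2
  exact hnot (GM.openConnIn_trans hxu (openConnIn_reverse hyu'))

/-! ### Good tiles inject into good units -/

/-- The centre of an `r`-ball lies in it. [folklore] -/
theorem self_mem_ball (r : ℕ) (a : Site 3) : a ∈ (box 3 r).image (· + a) :=
  Finset.mem_image.2 ⟨0, zero_mem_box 3 r, zero_add a⟩

/-- For `r ≥ 1`, `a + e₀` lies in the `r`-ball of `a`. [folklore] -/
theorem add_single_mem_ball {r : ℕ} (hr : 1 ≤ r) (a : Site 3) :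
    a + Pi.single 0 1 ∈ (box 3 r).image (· + a) := by
  refine Finset.mem_image.2 ⟨Pi.single 0 1, ?_, add_comm _ _⟩
  rw [mem_box]
  intro i
  by_cases hi : i = 0
  · subst hi; simp; omega
  · simp [hi]

/-- `a` and `a + e₀` are lattice neighbours. [folklore] -/
theorem zdGraph_adj_add_single (a : Site 3) : (zdGraph 3).Adj a (a + Pi.single 0 1) :=
  (zdGraph_adj_iff a (a + Pi.single 0 1)).2 ⟨0, Or.inl rfl⟩

/-- **Good tiles inject into good units** (`r ≥ 1`): the number of tile indices `ι` whose fibre contains a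
doubly-met `r`-ball `⊆ Λ` is at most the number of units of the family that contain all lattice edges of some
doubly-met `r`-ball `⊆ Λ`. Here `Px`, `Py` are arbitrary predicates on centres (the "met by the piece"
conditions). [folklore] -/
theorem ncard_goodTiles_le_card_goodUnits {r : ℕ} (hr : 1 ≤ r) (Λ : Finset (Site 3)) (t : Site 3 → Site 3)
    (Px Py : Site 3 → Prop) :
    Set.ncard {ι : Site 3 | ∃ a : Site 3, (box 3 r).image (· + a) ⊆ Λ ∧
        (∀ z ∈ (box 3 r).image (· + a), t z = ι) ∧ Px a ∧ Py a} ≤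
      (((Λ.image t).image (fun ι => (Λ.sym2).filter (fun e => e ∈ (zdGraph 3).edgeSet ∧ ∀ z ∈ e, t z = ι))).filter
        fun W => ∃ a : Site 3, (box 3 r).image (· + a) ⊆ Λ ∧
          (∀ b ∈ (box 3 r).image (· + a), ∀ c ∈ (box 3 r).image (· + a), (zdGraph 3).Adj b c → s(b, c) ∈ W) ∧
          Px a ∧ Py a).card := by
  rw [← Set.ncard_coe_finset]
  refine Set.ncard_le_ncard_of_injOn
    (fun ι => (Λ.sym2).filter (fun e => e ∈ (zdGraph 3).edgeSet ∧ ∀ z ∈ e, t z = ι)) ?_ ?_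
  · -- maps good tiles to good units
    rintro ι ⟨a, hball, ht, hPx, hPy⟩
    rw [Finset.mem_coe, Finset.mem_filter]
    have ha : a ∈ Λ := hball (self_mem_ball r a)
    have hta : t a = ι := ht a (self_mem_ball r a)
    refine ⟨?_, a, hball, fun b hb c hc hadj => mk_mem_unit_of_subset hball ht hb hc hadj, hPx, hPy⟩
    rw [← hta]
    exact unit_mem_units t ha
  · -- injective on good tiles
    rintro ι ⟨a, hball, ht, -, -⟩ ι' - hU
    have he : s(a, a + Pi.single 0 1) ∈
        (Λ.sym2).filter (fun e => e ∈ (zdGraph 3).edgeSet ∧ ∀ z ∈ e, t z = ι) :=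
      mk_mem_unit_of_subset hball ht (self_mem_ball r a) (add_single_mem_ball hr a) (zdGraph_adj_add_single a)
    have he' : s(a, a + Pi.single 0 1) ∈
        (Λ.sym2).filter (fun e => e ∈ (zdGraph 3).edgeSet ∧ ∀ z ∈ e, t z = ι') := by
      have hU' : (Λ.sym2).filter (fun e => e ∈ (zdGraph 3).edgeSet ∧ ∀ z ∈ e, t z = ι) =
          (Λ.sym2).filter (fun e => e ∈ (zdGraph 3).edgeSet ∧ ∀ z ∈ e, t z = ι') := hU
      rw [← hU']; exact he
    exact unit_eq_of_mem_of_mem he he'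

end StubCollarAssembly


/-- **Registered sub-goal `stub_collar_tiles`** (lead, line `ccfs-window-kissing-walls`): good tiles inject into
good units — `StubCollarAssembly.ncard_goodTiles_le_card_goodUnits` verbatim. [folklore] -/
theorem stub_collar_tiles : ∀ {r : ℕ}, 1 ≤ r → ∀ (Λ : Finset (Site 3)) (t : Site 3 → Site 3) (Px Py : Site 3 → Prop),
    Set.ncard {ι : Site 3 | ∃ a : Site 3, (box 3 r).image (· + a) ⊆ Λ ∧
        (∀ z ∈ (box 3 r).image (· + a), t z = ι) ∧ Px a ∧ Py a} ≤
      (((Λ.image t).image (fun ι => (Λ.sym2).filter (fun e => e ∈ (zdGraph 3).edgeSet ∧ ∀ z ∈ e, t z = ι))).filter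
        fun W => ∃ a : Site 3, (box 3 r).image (· + a) ⊆ Λ ∧
          (∀ b ∈ (box 3 r).image (· + a), ∀ c ∈ (box 3 r).image (· + a), (zdGraph 3).Adj b c → s(b, c) ∈ W) ∧
          Px a ∧ Py a).card :=
  fun hr Λ t Px Py => StubCollarAssembly.ncard_goodTiles_le_card_goodUnits hr Λ t Px Py

end Summit.CriticalPhenomena.PercolationContinuityZ3.Theorems.FreeBoxSparse

end
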